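import Summits.CriticalPhenomena.PercolationContinuityZ3.Theorems.PercNearOneGluingNoHeavyPcintBSMXCompute
import Summits.CriticalPhenomena.PercolationContinuityZ3.Theorems.PercNearOneGluingNoHeavyPcintBSMXAssembly
import HarnessLib

/-!
# PCINT lane, PHASE 6 (block renewal with reach-two pieces), step 6: the kernel theorem

Cell `prim-pcint`, seat `prim-pcint-1` (gen 15); memo `run/shared/lean/prim/pcint/T-FIBRE-ROUTE.md` §PHASE 6.

Part 2 of the kernel layer (the analogue of …PcintBSMKernel): the rational five-point law `BSMX.g₅q` and the rational
marginal identity `BSMX.MargQ5` over the coded list box `[-2,2]^t`, and **`BSMX.criticalProb_le_of_checks5`**: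
decidable hypotheses in natural/integer arithmetic (the reach-two cube conditions, the marginal identity, windowed
fixed-point Green-table domination on the sorted offsets of `[-12,12]^t` (…PcintBSMXCompute), potential-table
domination on `[-8,8]^t`, the PHASE-5 integer certificate functional `BSM.certLHSz` on `[-4,4]^t`), plus a tail bound
`BSMX.TailBoundH` (discharged from `ℚ` data in …PcintBSMXTails), imply `p_c^bond(ℤ^{k+t}) ≤ P/10^4`.
-/

noncomputable section

namespace Summit.CriticalPhenomena.PercolationContinuityZ3.Theorems.Pcint.BSMX

open Finset OSM BSM Literature.Probability.Percolation Literature.Probability.LatticeModels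

variable {t k np : ℕ}

/-! ### The rational marginal identity -/

/-- Every letter vector is coded by a point of `[-2,2]^t`. -/
theorem exists_boxList_code5 (v : Fin t → Fin 5) : ∃ δ ∈ boxList t 2, v = fun i => code5 (δ i) := by
  refine ⟨fun i => val5 (v i), (mem_boxList 2 _).2 fun i => ?_, funext fun i => (code5_val5 (v i)).symm⟩
  unfold val5; have := (v i).2; constructor <;> push_cast <;> omega

/-- The five-point law over `ℚ`. -/
def g₅q (a₁ a₂ : ℚ) (c : Fin 5) : ℚ := if c = 2 then 1 - 2 * a₁ - 2 * a₂ else if c = 1 ∨ c = 3 then a₁ else a₂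

/-- `g₅q` casts to `g₅`. -/
theorem g₅q_cast (a₁ a₂ : ℚ) (c : Fin 5) : ((g₅q a₁ a₂ c : ℚ) : ℝ) = g₅ (a₁ : ℝ) (a₂ : ℝ) c := by
  unfold g₅q g₅; split_ifs <;> push_cast <;> ring

/-- **The rational marginal hypothesis**, quantified over the list box `[-2,2]^t` of coded letter vectors. -/
def MargQ5 (pc : Fin np → List (Fin t × Bool)) (wq : Fin np → ℚ) (a₁ a₂ : ℚ) : Prop :=
  ∀ δ ∈ boxList t 2, ∑ σ : Fin np, (if codev5 pc σ = (fun i => code5 (δ i)) then wq σ else 0) =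
    ∏ i, g₅q a₁ a₂ (code5 (δ i))

/-- The rational marginal hypothesis gives the real one. -/
theorem marg_of_margQ5 {pc : Fin np → List (Fin t × Bool)} {wq : Fin np → ℚ} {a₁ a₂ : ℚ} (h : MargQ5 pc wq a₁ a₂) :
    Marg5 pc (fun σ => (wq σ : ℝ)) (a₁ : ℝ) (a₂ : ℝ) := by
  intro v
  obtain ⟨δ, hδ, rfl⟩ := exists_boxList_code5 v
  have := congr_arg (fun q : ℚ => (q : ℝ)) (h δ hδ)
  push_cast at this
  simp only [g₅q_cast] at this
  convert this using 2 with σ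
  split_ifs <;> simp

/-- Sums of naturals over the list box `[-4,4]^t`, cast to `ℝ`. -/
theorem cast_boxSum4 (G Φn : (Fin t → ℤ) → ℕ) (Tn : ℕ) (u : Fin t → ℤ) :
    (((1 + ((boxList t 4).map fun z => (G (canonK (z - u)) + Tn) * Φn z).sum : ℕ) : ℝ)) =
      1 + ∑ z ∈ Box t 4, (((G (canonK (z - u)) : ℝ) + Tn) * Φn z) := by
  rw [Nat.cast_add, Nat.cast_one, Nat.cast_list_sum, List.map_map, sum_Box_eq]
  congr 1
  exact congr_arg _ (List.map_congr_left fun z _ => by simp only [Function.comp_apply]; push_cast; ring)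

/-! ### Green-table hypotheses from the fixed-point check -/

/-- **The diagonal Green table from the fixed-point check**: `GqN (termsH … U) · DG ≤ G0n · (DU · D^t)` gives
`G0H N δ · DG ≤ G0n δ`. -/
theorem G0H_le_of_check {A0 A1 A2 DA : ℕ} (hDA : A0 + 2 * A1 + 2 * A2 = DA) (hDA0 : 0 < DA) {D DU : ℕ} (hD : 0 < D)
    (hDU : 0 < DU) {W N : ℕ} (hW : 12 ≤ W) {U : List ℕ}
    (hU : ∀ i ∈ List.range N, uqv (OSM.vrow k N) k i * DU ≤ (U.getD i 0 : ℚ)) {DG : ℕ} {G0n : (Fin t → ℤ) → ℕ}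
    {δ : Fin t → ℤ} (hδ : δ ∈ Box t 12) (h : GqN (termsH A0 A1 A2 DA D W N 12 U) 12 δ * DG ≤ G0n δ * (DU * D ^ t)) :
    G0H k ((A1 : ℝ) / DA) ((A2 : ℝ) / DA) N δ * DG ≤ G0n δ := by
  have hU' : ∀ i < N, u k i * DU ≤ (U.getD i 0 : ℝ) := fun i hi => by
    have h := (Rat.cast_le (K := ℝ)).2 (hU i (List.mem_range.2 hi))
    push_cast at h
    rwa [uqv_cast hi.le] at h
  have hM : (0 : ℝ) < (DU : ℝ) * (D : ℝ) ^ t := by positivity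
  have h1 := G0H_le_GqN (k := k) hDA hDA0 D DU hW hU' hδ
  have h2 : ((GqN (termsH A0 A1 A2 DA D W N 12 U) 12 δ : ℕ) : ℝ) * DG ≤ (G0n δ : ℝ) * ((DU : ℝ) * (D : ℝ) ^ t) := by
    exact_mod_cast h
  have hDG : (0 : ℝ) ≤ DG := Nat.cast_nonneg DG
  nlinarith [h1, h2, hM, mul_le_mul_of_nonneg_right h1 hDG]

/-- **The adjacent Green table from the fixed-point check.** -/
theorem G1H_le_of_check (hk : 2 ≤ k) {A0 A1 A2 DA : ℕ} (hDA : A0 + 2 * A1 + 2 * A2 = DA) (hDA0 : 0 < DA) {D DU : ℕ}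
    (hD : 0 < D) (hDU : 0 < DU) {W N : ℕ} (hW : 12 ≤ W) {C : List ℕ}
    (hC : ∀ i ∈ List.range N, cadjqv (OSM.vrow k (N + 1)) k i * DU ≤ (C.getD i 0 : ℚ)) {DG : ℕ}
    {G1n : (Fin t → ℤ) → ℕ} {δ : Fin t → ℤ} (hδ : δ ∈ Box t 12)
    (h : GqN (termsH A0 A1 A2 DA D W N 12 C) 12 δ * DG ≤ G1n δ * (DU * D ^ t)) :
    G1H k ((A1 : ℝ) / DA) ((A2 : ℝ) / DA) N δ * DG ≤ G1n δ := by
  have hC' : ∀ i < N, cadj k i * DU ≤ (C.getD i 0 : ℝ) := fun i hi => by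
    have h := (Rat.cast_le (K := ℝ)).2 (hC i (List.mem_range.2 hi))
    push_cast at h
    rwa [cadjqv_cast (by omega)] at h
  have hM : (0 : ℝ) < (DU : ℝ) * (D : ℝ) ^ t := by positivity
  have h1 := G1H_le_GqN (k := k) hDA hDA0 D DU hW hC' hδ
  have h2 : ((GqN (termsH A0 A1 A2 DA D W N 12 C) 12 δ : ℕ) : ℝ) * DG ≤ (G1n δ : ℝ) * ((DU : ℝ) * (D : ℝ) ^ t) := by
    exact_mod_cast h
  have hDG : (0 : ℝ) ≤ DG := Nat.cast_nonneg DG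
  have hG1 : 0 ≤ G1H k ((A1 : ℝ) / DA) ((A2 : ℝ) / DA) N δ := by
    unfold G1H
    have hDAR : (0 : ℝ) < DA := by exact_mod_cast hDA0
    have h12 : 2 * ((A1 : ℝ) / DA) + 2 * ((A2 : ℝ) / DA) ≤ 1 := by
      have : (2 * A1 + 2 * A2 : ℝ) ≤ DA := by exact_mod_cast (by omega : 2 * A1 + 2 * A2 ≤ DA)
      rw [show 2 * ((A1 : ℝ) / DA) + 2 * ((A2 : ℝ) / DA) = (2 * A1 + 2 * A2) / DA by ring, div_le_one hDAR]
      exact this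
    exact sum_nonneg fun i _ => mul_nonneg (cadj_bounds hk i).1
      (prod_nonneg fun l _ => H_nonneg (by positivity) (by positivity) h12 _ _)
  nlinarith [h1, h2, hM, mul_le_mul_of_nonneg_right h1 hDG]

/-! ### The kernel theorem -/

/-- **`p_c^bond(ℤ^{k+t}) ≤ P/10^4` from decidable checks** (integer certificate). -/
theorem criticalProb_le_of_checks5 (hk : 2 ≤ k) (pc : Fin np → List (Fin t × Bool))
    (pe : Fin np → (Fin t → ℤ)) (hpe : ∀ σ, pe σ = pend (pc σ)) (E : ℕ) (hE : ∀ σ, (pc σ).length + 1 ≤ E)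
    (St : (Fin t → ℤ) → Fin np → Fin np → ℕ) (hSt : ∀ y ∈ boxList t 4, ∀ σ σ', St y σ σ' = S pc k y σ σ')
    (W : Fin np → ℕ) (DW : ℕ) (hDW : 0 < DW)
    {A1 A2 DA : ℕ}
    (hcube : Cube2 pc) (hkc : KeyCube2 pc k)
    (hmarg : MargQ5 pc (fun σ => (W σ : ℚ) / DW) ((A1 : ℚ) / DA) ((A2 : ℚ) / DA)) {P : ℕ} (hP0 : 0 < P) (hP1 : P ≤ 10000)
    {N : ℕ} (DG DΦ Tn : ℕ) (hDG : 0 < DG) (hDΦ : 0 < DΦ)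
    (hT : TailBoundH t k ((A1 : ℝ) / DA) ((A2 : ℝ) / DA) N ((Tn : ℝ) / DG))
    (G0n G1n V0n V1n Φn : (Fin t → ℤ) → ℕ) (CL : List (Fin t → ℤ)) (hCL : ∀ δ ∈ boxList t 12, canonK δ ∈ CL)
    (hG0 : ∀ δ ∈ CL, G0H k ((A1 : ℝ) / DA) ((A2 : ℝ) / DA) N δ * DG ≤ G0n δ)
    (hG1 : ∀ δ ∈ CL, G1H k ((A1 : ℝ) / DA) ((A2 : ℝ) / DA) N δ * DG ≤ G1n δ)
    (hV0 : ∀ u ∈ boxList t 8, 1 + ((boxList t 4).map fun z => (G0n (canonK (z - u)) + Tn) * Φn z).sum ≤ V0n u)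
    (hV1 : ∀ u ∈ boxList t 8, 1 + ((boxList t 4).map fun z => (G1n (canonK (z - u)) + Tn) * Φn z).sum ≤ V1n u)
    (hcert : ∀ y ∈ boxList t 4, certLHSz pe St W k 10000 P E V0n V1n y * DΦ ≤
      (Φn y : ℤ) * ((P ^ E * k * DW ^ 2 * (DG * DΦ) : ℕ) : ℤ)) :
    criticalProb (zdGraph (k + t)) (0 : Site (k + t)) ≤ (P : ℝ) / 10000 := by
  have hPR : (0 : ℝ) < P := by exact_mod_cast hP0
  have hDGR : (0 : ℝ) < DG := by exact_mod_cast hDG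
  have hDΦR : (0 : ℝ) < DΦ := by exact_mod_cast hDΦ
  have hDWR : (0 : ℝ) < DW := by exact_mod_cast hDW
  set a₁ : ℝ := (((A1 : ℚ) / DA : ℚ) : ℝ) with ha₁
  set a₂ : ℝ := (((A2 : ℚ) / DA : ℚ) : ℝ) with ha₂
  have ha₁' : a₁ = (A1 : ℝ) / DA := by rw [ha₁]; push_cast; rfl
  have ha₂' : a₂ = (A2 : ℝ) / DA := by rw [ha₂]; push_cast; rfl
  have hp0 : (0 : ℝ) < (P : ℝ) / 10000 := by positivity
  have hp1 : (P : ℝ) / 10000 ≤ 1 := by rw [div_le_one (by norm_num)]; exact_mod_cast hP1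
  -- the weights
  set w : Fin np → ℝ := fun σ => (W σ : ℝ) / DW with hw
  have hmarg' : Marg5 pc w a₁ a₂ := by
    have h := marg_of_margQ5 hmarg
    have : (fun σ => ((((W σ : ℚ) / DW : ℚ)) : ℝ)) = w := by funext σ; rw [hw]; push_cast; rfl
    rwa [this] at h
  have hw0 : ∀ σ, 0 ≤ w σ := fun σ => by rw [hw]; positivity
  -- boxes: `z ∈ [-4,4]^t`, `u ∈ [-8,8]^t` ⇒ `z - u ∈ [-12,12]^t`
  have hzu : ∀ z ∈ boxList t 4, ∀ u ∈ boxList t 8, z - u ∈ boxList t 12 := by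
    intro z hz u hu
    rw [mem_boxList] at hz hu ⊢
    intro i
    have h1 := hz i; have h2 := hu i
    simp only [Pi.sub_apply]
    push_cast at h1 h2 ⊢
    constructor <;> omega
  have hYb : ∀ z, z ∈ Box t 4 → z ∈ boxList t 4 := fun z hz => by
    rwa [Box_eq_toFinset t 4, List.mem_toFinset] at hz
  -- the potential, extended by zero outside `[-4,4]^t`, and the tables over `ℝ`
  set φ : (Fin t → ℤ) → ℝ := fun y => if y ∈ boxList t 4 then (Φn y : ℝ) / DΦ else 0 with hφdef
  have hφ0 : ∀ y, 0 ≤ φ y := fun y => by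
    rw [hφdef]; dsimp only; split_ifs
    · positivity
    · exact le_rfl
  have hφin : ∀ y ∈ boxList t 4, φ y = (Φn y : ℝ) / DΦ := fun y hy => by rw [hφdef]; dsimp only; rw [if_pos hy]
  set V0f : (Fin t → ℤ) → ℝ := fun u => (V0n u : ℝ) / ((DG * DΦ : ℕ) : ℝ) with hV0f
  set V1f : (Fin t → ℤ) → ℝ := fun u => (V1n u : ℝ) / ((DG * DΦ : ℕ) : ℝ) with hV1f
  -- Green tables over `ℝ`
  have hG0' : ∀ z ∈ boxList t 4, ∀ u ∈ boxList t 8,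
      G0H k a₁ a₂ N (z - u) + (Tn : ℝ) / DG ≤ (((G0n (canonK (z - u)) : ℝ) + Tn) / DG) := by
    intro z hz u hu
    rw [add_div]
    refine add_le_add ?_ le_rfl
    rw [← G0H_canonK, le_div_iff₀ hDGR, ha₁', ha₂']
    exact hG0 _ (hCL _ (hzu z hz u hu))
  have hG1' : ∀ z ∈ boxList t 4, ∀ u ∈ boxList t 8,
      G1H k a₁ a₂ N (z - u) + (Tn : ℝ) / DG ≤ (((G1n (canonK (z - u)) : ℝ) + Tn) / DG) := by
    intro z hz u hu
    rw [add_div]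
    refine add_le_add ?_ le_rfl
    rw [← G1H_canonK, le_div_iff₀ hDGR, ha₁', ha₂']
    exact hG1 _ (hCL _ (hzu z hz u hu))
  -- the potential tables over `ℝ`
  have hVgen : ∀ (Gr : (Fin t → ℤ) → ℝ) (Gn Vn : (Fin t → ℤ) → ℕ),
      (∀ z ∈ boxList t 4, ∀ u ∈ boxList t 8, Gr (z - u) + (Tn : ℝ) / DG ≤ (((Gn (canonK (z - u)) : ℝ) + Tn) / DG)) →
      (∀ u ∈ boxList t 8, 1 + ((boxList t 4).map fun z => (Gn (canonK (z - u)) + Tn) * Φn z).sum ≤ Vn u) →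
      ∀ u ∈ Box t 8, (1 / ((DG * DΦ : ℕ) : ℝ) + ∑ z ∈ Box t 4, (Gr (z - u) + (Tn : ℝ) / DG) * φ z) ≤
        (Vn u : ℝ) / ((DG * DΦ : ℕ) : ℝ) := by
    intro Gr Gn Vn hGr hVn u hu
    rw [Box_eq_toFinset, List.mem_toFinset] at hu
    have hsum : ∑ z ∈ Box t 4, (Gr (z - u) + (Tn : ℝ) / DG) * φ z ≤
        ∑ z ∈ Box t 4, ((((Gn (canonK (z - u)) : ℝ) + Tn) / DG) * ((Φn z : ℝ) / DΦ)) :=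
      sum_le_sum fun z hz => by
        rw [hφin z (hYb z hz)]
        exact mul_le_mul_of_nonneg_right (hGr z (hYb z hz) u hu) (by positivity)
    have hcast : ((Vn u : ℝ)) ≥ ((1 + ((boxList t 4).map fun z => (Gn (canonK (z - u)) + Tn) * Φn z).sum : ℕ) : ℝ) := by
      exact_mod_cast hVn u hu
    rw [cast_boxSum4] at hcast
    have heq : ∑ z ∈ Box t 4, ((((Gn (canonK (z - u)) : ℝ) + Tn) / DG) * ((Φn z : ℝ) / DΦ)) =
        (∑ z ∈ Box t 4, (((Gn (canonK (z - u)) : ℝ) + Tn) * Φn z)) / ((DG * DΦ : ℕ) : ℝ) := by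
      rw [Finset.sum_div]
      exact sum_congr rfl fun z _ => by push_cast; ring
    rw [heq] at hsum
    have hpos : (0 : ℝ) < ((DG * DΦ : ℕ) : ℝ) := by positivity
    calc 1 / ((DG * DΦ : ℕ) : ℝ) + ∑ z ∈ Box t 4, (Gr (z - u) + (Tn : ℝ) / DG) * φ z
        ≤ (1 + ∑ z ∈ Box t 4, (((Gn (canonK (z - u)) : ℝ) + Tn) * Φn z)) / ((DG * DΦ : ℕ) : ℝ) := by
          rw [add_div]; exact add_le_add le_rfl hsum
      _ ≤ (Vn u : ℝ) / ((DG * DΦ : ℕ) : ℝ) := div_le_div_of_nonneg_right hcast hpos.le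
  have hV0' : ∀ u ∈ Box t 8, V0H k a₁ a₂ N ((Tn : ℝ) / DG) (1 / ((DG * DΦ : ℕ) : ℝ)) φ u ≤ V0f u :=
    hVgen (G0H k a₁ a₂ N) G0n V0n hG0' hV0
  have hV1' : ∀ u ∈ Box t 8, V1H k a₁ a₂ N ((Tn : ℝ) / DG) (1 / ((DG * DΦ : ℕ) : ℝ)) φ u ≤ V1f u :=
    hVgen (G1H k a₁ a₂ N) G1n V1n hG1' hV1
  have hT' : TailBoundH t k a₁ a₂ N ((Tn : ℝ) / DG) := by rw [ha₁', ha₂']; exact hT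
  -- the certificate inequalities over `ℝ`
  have hx : (1 / ((P : ℝ) / 10000)) = ((10000 : ℕ) : ℝ) / P := by push_cast; field_simp
  have hcert' : ∀ y ∈ Box t 4, certLHS pc w k (1 / ((P : ℝ) / 10000)) V0f V1f y ≤ φ y := by
    intro y hy
    replace hy := hYb y hy
    have h := (Int.cast_mono (R := ℝ)) (hcert y hy)
    have hSt' : certLHSz pe St W k 10000 P E V0n V1n y = certLHSz pe (S pc k) W k 10000 P E V0n V1n y := by
      unfold certLHSz; simp only [hSt y hy]
    rw [hSt'] at h
    push_cast at h
    rw [certLHSz_cast pc hpe W (by omega) 10000 hP0 hE V0n V1n y hDW (by positivity : 0 < DG * DΦ)] at h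
    rw [hx, hφin y hy]
    rw [hw, hV0f, hV1f]
    push_cast at h ⊢
    have hMpos : (0 : ℝ) < (k : ℝ) * (P : ℝ) ^ E * (DW : ℝ) ^ 2 * ((DG : ℝ) * DΦ) * DΦ := by positivity
    refine le_of_mul_le_mul_right ?_ hMpos
    calc _ = certLHS pc (fun σ => (W σ : ℝ) / DW) k ((10000 : ℝ) / P) (fun u => (V0n u : ℝ) / ((DG : ℝ) * DΦ))
          (fun u => (V1n u : ℝ) / ((DG : ℝ) * DΦ)) y * ((k : ℝ) * (P : ℝ) ^ E * (DW : ℝ) ^ 2 * ((DG : ℝ) * DΦ)) * DΦ := by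
          ring
      _ ≤ (Φn y : ℝ) * ((P : ℝ) ^ E * k * (DW : ℝ) ^ 2 * ((DG : ℝ) * DΦ)) := h
      _ = _ := by field_simp
  exact criticalProb_le_of_cert5 hk hcube hkc hmarg' hw0 hp0 hp1 hT' (by positivity) φ hφ0 hV0' hV1' hcert'

end Summit.CriticalPhenomena.PercolationContinuityZ3.Theorems.Pcint.BSMX

end
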